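import Summits.HodgeConjecture.HodgeConjecture.Cruxes.BlochSeedDiscOne.PhaseTorusLawAllCoranks

/-!
# BOX LAW ∕ μ-lattice theorem on the phase torus (control g6, 2026-08-29) — torus level, SORRY-FREE target

Nothing here proves HC, HC_AV, HC_CM, H2 or 18881; census-neutral finite harmonic analysis on `(μ₄)⁴`, companion of
`PhaseTorusLaw.lean` (PART C `pairing_expansion`) and `PhaseTorusLawAllCoranks.lean` (`PhaseTorusLawN`).  Pen proof + data:
`Cruxes/BlochSeedDiscOne/BOX-LAW-g6.md` §2.

CONTENT.  For a real signed measure `ω` on the phase torus with vanishing clean moments (`KAdm k → moment ω k = 0`) and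
`μ = moment ω (1,1,1,1)`:
* `boxLaw`   — the mass of every phase BOX `s + {0,1}⁴` is `32 · N(s) = −Re(e(−Σ s) · μ)`;
* `slabLaw`  — every proper SLAB (coordinates in `S ⊊ univ` boxed, the rest free) has mass `0`;
* `moment_one_eq_boxSums` — `μ = −32 · (N(0) + i · N(e₀))`;
* `moment_one_mem_32`, `norm_moment_one_ge` — for INTEGER `ω`: `μ ∈ 32ℤ[i]` and `μ ≠ 0 ⇒ ‖μ‖ ≥ 32`;
* `phaseTorusLawN_ten` — the phase-torus law at corank ≤ 10 (pbox law + double counting over one pbox class).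
Mechanism: the pair indicator `1_{{s,s+1}} = 1 − ½·bumpPair s` has no frequency `2` and frequency-`±1` coefficients
`−conj(z_s)/4`, `−z_s/4`; so a pbox∕slab indicator pairs with `ω` through the two top moments only (`pairing_expansion`, as in `rot_step`).
-/

namespace Summit.HodgeConjecture.HodgeConjecture.Cruxes.BlochSeedDiscOne.PhaseTorus

open Finset BigOperators

/-! ## §1 boxes and slabs -/

/-- the phase BOX with corner `s`: `∏_f {s_f, s_f + 1}` (16 points of the torus). -/
def pbox (s : PT) : Finset PT := Finset.univ.filter fun τ => ∀ f, τ f = s f ∨ τ f = s f + 1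

/-- the SLAB boxed on the coordinates in `S`, free elsewhere. -/
def slab (S : Finset (Fin 4)) (s : PT) : Finset PT := Finset.univ.filter fun τ => ∀ f ∈ S, τ f = s f ∨ τ f = s f + 1

/-- signed mass of `ω` in the pbox with corner `s`. -/
def boxSum (ω : PT → ℝ) (s : PT) : ℝ := ∑ τ ∈ pbox s, ω τ

theorem mem_pbox {s τ : PT} : τ ∈ pbox s ↔ ∀ f, τ f = s f ∨ τ f = s f + 1 := by
  simp [pbox]

theorem mem_slab {S : Finset (Fin 4)} {s τ : PT} : τ ∈ slab S s ↔ ∀ f ∈ S, τ f = s f ∨ τ f = s f + 1 := by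
  simp [slab]

theorem pbox_eq_slab_univ (s : PT) : pbox s = slab Finset.univ s := by
  ext τ; simp [mem_pbox, mem_slab]

/-! ## §2 the pair indicator `1_{{s,s+1}} = 1 − ½ bumpPair s` and its frequency table `coefBox` -/

/-- indicator of the adjacent pair `{s, s+1}`. -/
noncomputable def boxInd (s t : ZMod 4) : ℝ := if t = s ∨ t = s + 1 then 1 else 0

theorem boxInd_eq (s t : ZMod 4) : boxInd s t = 1 - bumpPair s t / 2 := by
  unfold boxInd bumpPair; split_ifs <;> norm_num

theorem boxInd_nonneg (s t : ZMod 4) : 0 ≤ boxInd s t := by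
  unfold boxInd; split_ifs <;> norm_num

/-- frequency table of `boxInd s`: `1/2` at `0`, `−conj(z_s)/4` at `1`, `−z_s/4` at `3`, `0` at `2`. -/
noncomputable def coefBox (s j : ZMod 4) : ℂ :=
  if j = 0 then 1 / 2 else if j = 1 then -(starRingEnd ℂ) (zPair s) / 4 else if j = 3 then -zPair s / 4 else 0

theorem coefBox_eq (s j : ZMod 4) : coefBox s j = (if j = 0 then (1 : ℂ) else 0) - coefPair s j / 2 := by
  rcases zmod4_cases j with rfl | rfl | rfl | rfl
  · rw [if_pos rfl, coefPair_zero]; simp [coefBox]; norm_num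
  · rw [if_neg (by decide), coefPair_one]; simp [coefBox, show (1 : ZMod 4) ≠ 0 from by decide]; ring
  · rw [if_neg (by decide), coefPair_two]
    simp [coefBox, show (2 : ZMod 4) ≠ 0 from by decide, show (2 : ZMod 4) ≠ 1 from by decide,
      show (2 : ZMod 4) ≠ 3 from by decide]
  · rw [if_neg (by decide), coefPair_three]
    simp [coefBox, show (3 : ZMod 4) ≠ 0 from by decide, show (3 : ZMod 4) ≠ 1 from by decide]; ring

theorem coefBox_one (s : ZMod 4) : coefBox s 1 = -(starRingEnd ℂ) (zPair s) / 4 := by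
  simp [coefBox, show (1 : ZMod 4) ≠ 0 from by decide]

theorem coefBox_two (s : ZMod 4) : coefBox s 2 = 0 := by
  rw [coefBox_eq, if_neg (by decide), coefPair_two]; simp

theorem coefBox_three_eq_conj (s : ZMod 4) : coefBox s 3 = (starRingEnd ℂ) (coefBox s 1) := by
  rw [coefBox_eq, coefBox_eq, if_neg (by decide), if_neg (by decide), coefPair_three_eq_conj, map_sub, map_zero,
    map_div₀]
  congr 2
  exact (Complex.conj_ofNat 2).symm

/-- the three-term character expansion of the pair indicator. -/
theorem boxInd_expand (s t : ZMod 4) :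
    (boxInd s t : ℂ) = ∑ j : ZMod 4, coefBox s j * Complex.I ^ ((j * t).val) := by
  have hA : ∑ j : ZMod 4, (if j = 0 then (1 : ℂ) else 0) * Complex.I ^ ((j * t).val) = 1 := by
    rw [Finset.sum_eq_single (0 : ZMod 4)]
    · simp
    · intro j _ hj; rw [if_neg hj, zero_mul]
    · intro h; exact absurd (Finset.mem_univ _) h
  have hB : ∑ j : ZMod 4, coefBox s j * Complex.I ^ ((j * t).val) =
      1 - (∑ j : ZMod 4, coefPair s j * Complex.I ^ ((j * t).val)) / 2 := by
    rw [Finset.sum_div, ← hA, ← Finset.sum_sub_distrib]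
    refine Finset.sum_congr rfl fun j _ => ?_
    rw [coefBox_eq]; ring
  rw [hB, ← bumpPair_expand, boxInd_eq]; push_cast; ring

/-- frequency table of the constant function `1` (a free coordinate). -/
noncomputable def coefOne (j : ZMod 4) : ℂ := if j = 0 then 1 else 0

theorem one_expand (t : ZMod 4) : ((1 : ℝ) : ℂ) = ∑ j : ZMod 4, coefOne j * Complex.I ^ ((j * t).val) := by
  rw [Finset.sum_eq_single (0 : ZMod 4)]
  · simp [coefOne]
  · intro j _ hj; rw [coefOne, if_neg hj, zero_mul]
  · intro h; exact absurd (Finset.mem_univ _) h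

/-! ## §3 the slab test function: coefficient vectors `svec`, values `uvec`, the reduced pairing -/

/-- coefficient tables of the slab indicator: `coefBox (s f)` on boxed coordinates, `coefOne` on free ones. -/
noncomputable def svec (S : Finset (Fin 4)) (s : PT) (f : Fin 4) : ZMod 4 → ℂ :=
  if f ∈ S then coefBox (s f) else coefOne

/-- values of the factors of the slab indicator. -/
noncomputable def uvec (S : Finset (Fin 4)) (s : PT) (f : Fin 4) (t : ZMod 4) : ℝ :=
  if f ∈ S then boxInd (s f) t else 1

theorem svec_two (S : Finset (Fin 4)) (s : PT) (f : Fin 4) : svec S s f 2 = 0 := by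
  unfold svec coefOne; split_ifs
  · exact coefBox_two _
  · simp [show (2 : ZMod 4) ≠ 0 from by decide]

theorem svec_three (S : Finset (Fin 4)) (s : PT) (f : Fin 4) :
    svec S s f 3 = (starRingEnd ℂ) (svec S s f 1) := by
  unfold svec coefOne; split_ifs
  · exact coefBox_three_eq_conj _
  · simp [show (3 : ZMod 4) ≠ 0 from by decide, show (1 : ZMod 4) ≠ 0 from by decide]

theorem trig_svec (S : Finset (Fin 4)) (s : PT) (f : Fin 4) (t : ZMod 4) :
    ∑ j : ZMod 4, svec S s f j * Complex.I ^ ((j * t).val) = (uvec S s f t : ℂ) := by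
  unfold svec uvec; split_ifs
  · exact (boxInd_expand _ t).symm
  · exact (one_expand t).symm

/-- the product of the factor values is the slab indicator. -/
theorem prod_uvec_eq (S : Finset (Fin 4)) (s τ : PT) :
    ∏ f, uvec S s f (τ f) = if (∀ f, f ∈ S → (τ f = s f ∨ τ f = s f + 1)) then 1 else 0 := by
  have h : ∀ f, uvec S s f (τ f) = if (f ∈ S → (τ f = s f ∨ τ f = s f + 1)) then (1 : ℝ) else 0 := by
    intro f; unfold uvec boxInd; by_cases hf : f ∈ S <;> simp [hf]
  simp_rw [h]
  rw [Finset.prod_boole]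
  simp

/-- **reduced pairing**: `Σ_τ ω τ · 1_slab(τ) = 2 Re( (∏_f svec_f(1)) · μ )` for clean `ω`. -/
theorem slab_pairing (ω : PT → ℝ) (hK : ∀ k, KAdm k → moment ω k = 0) (S : Finset (Fin 4)) (s : PT) :
    ∑ τ : PT, ω τ * ∏ f, uvec S s f (τ f) = 2 * ((∏ f, svec S s f 1) * moment ω (fun _ => 1)).re := by
  have hS := pairing_expansion ω (svec S s)
  have hred : ∑ k : PT, (∏ f, svec S s f (k f)) * moment ω k =
      (∏ f, svec S s f 1) * moment ω (fun _ => 1) + (∏ f, svec S s f 3) * moment ω (fun _ => 3) := by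
    have hne : (fun _ => (1 : ZMod 4) : PT) ≠ (fun _ => 3) := fun h => absurd (congr_fun h 0) (by decide)
    rw [Finset.sum_eq_add (fun _ => (1 : ZMod 4)) (fun _ => (3 : ZMod 4)) hne]
    · intro k _ hk
      by_cases h : ∃ f, k f = 2
      · obtain ⟨f, hf⟩ := h
        rw [Finset.prod_eq_zero (Finset.mem_univ f) (by rw [hf, svec_two]), zero_mul]
      · rw [hK k ⟨fun f hf => h ⟨f, hf⟩, hk.1, hk.2⟩, mul_zero]
    · intro h; exact absurd (Finset.mem_univ _) h
    · intro h; exact absurd (Finset.mem_univ _) h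
  have hc3 : ∏ f, svec S s f 3 = (starRingEnd ℂ) (∏ f, svec S s f 1) := by
    rw [map_prod]; exact Finset.prod_congr rfl fun f _ => svec_three S s f
  rw [hred, hc3, moment_three_eq_conj_moment_one, ← map_mul, Complex.add_conj] at hS
  have hreal : ∑ τ : PT, (ω τ : ℂ) * ∏ f, (∑ j : ZMod 4, svec S s f j * Complex.I ^ ((j * τ f).val)) =
      ((∑ τ : PT, ω τ * ∏ f, uvec S s f (τ f) : ℝ) : ℂ) := by
    push_cast
    refine Finset.sum_congr rfl fun τ _ => ?_
    congr 1
    exact Finset.prod_congr rfl fun f _ => trig_svec S s f (τ f)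
  rw [hreal] at hS
  exact_mod_cast hS

/-- the slab sum as a pairing with the product test function. -/
theorem slabSum_eq_pairing (ω : PT → ℝ) (S : Finset (Fin 4)) (s : PT) :
    ∑ τ ∈ slab S s, ω τ = ∑ τ, ω τ * ∏ f, uvec S s f (τ f) := by
  rw [slab, Finset.sum_filter]
  refine Finset.sum_congr rfl fun τ _ => ?_
  rw [prod_uvec_eq]
  split_ifs <;> simp

/-! ## §4 the frequency-`(1,1,1,1)` coefficient of a slab∕pbox indicator -/

theorem coefOne_one : coefOne 1 = 0 := by
  simp [coefOne, show (1 : ZMod 4) ≠ 0 from by decide]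

/-- a proper slab has no top-frequency component. -/
theorem prod_svec_one_of_ne {S : Finset (Fin 4)} (hS : S ≠ Finset.univ) (s : PT) : ∏ f, svec S s f 1 = 0 := by
  obtain ⟨f, hf⟩ : ∃ f, f ∉ S := by
    by_contra h
    push_neg at h
    exact hS (Finset.eq_univ_of_forall h)
  exact Finset.prod_eq_zero (Finset.mem_univ f) (by simp [svec, hf, coefOne_one])

theorem conj_zPair (s : ZMod 4) : (starRingEnd ℂ) (zPair s) = (-1 + Complex.I) * e (-s) := by
  unfold zPair
  rw [map_mul, e_neg]
  congr 1
  rw [map_sub, map_neg, map_one, Complex.conj_I]; ring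

theorem coefBox_one_eq (s : ZMod 4) : coefBox s 1 = (1 - Complex.I) / 4 * e (-s) := by
  rw [coefBox_one, conj_zPair]; ring

theorem quarter_pow_four : ((1 - Complex.I) / 4) ^ 4 = -1 / 64 := by
  have hI : Complex.I ^ 2 = -1 := Complex.I_sq
  linear_combination (Complex.I ^ 2 - 4 * Complex.I + 5) / 256 * hI

/-- the top-frequency coefficient of a full pbox: `−e(−Σ s)/64`. -/
theorem prod_svec_one_univ (s : PT) : ∏ f, svec Finset.univ s f 1 = -(e (-∑ f, s f)) / 64 := by
  have h : ∀ f, svec Finset.univ s f 1 = (1 - Complex.I) / 4 * e ((fun f => -s f) f) := fun f => by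
    simp [svec, coefBox_one_eq]
  simp_rw [h]
  rw [Finset.prod_mul_distrib, Finset.prod_const, Finset.card_univ, Fintype.card_fin, quarter_pow_four, ← e_sum,
    Finset.sum_neg_distrib]
  ring

/-! ## §5 the laws -/

/-- **SLAB LAW**: a clean measure has mass `0` in every proper slab. -/
theorem slabLaw (ω : PT → ℝ) (hK : ∀ k, KAdm k → moment ω k = 0) (S : Finset (Fin 4)) (hS : S ≠ Finset.univ)
    (s : PT) : ∑ τ ∈ slab S s, ω τ = 0 := by
  rw [slabSum_eq_pairing, slab_pairing ω hK S s, prod_svec_one_of_ne hS, zero_mul, Complex.zero_re, mul_zero]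

/-- **BOX LAW**: `32 · N(s) = −Re(e(−Σ s) · μ)`. -/
theorem boxLaw (ω : PT → ℝ) (hK : ∀ k, KAdm k → moment ω k = 0) (s : PT) :
    32 * boxSum ω s = -(e (-∑ f, s f) * moment ω (fun _ => 1)).re := by
  rw [boxSum, pbox_eq_slab_univ, slabSum_eq_pairing, slab_pairing ω hK Finset.univ s, prod_svec_one_univ]
  rw [show -(e (-∑ f, s f)) / 64 * moment ω (fun _ => 1) = ((-(1 / 64) : ℝ) : ℂ) * (e (-∑ f, s f) * moment ω (fun _ => 1)) by
    push_cast; ring, Complex.re_ofReal_mul]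
  ring

theorem e_neg_one : e (-1) = -Complex.I := by
  rw [show (-1 : ZMod 4) = 3 from by decide, e_three]

theorem sum_single_zero_one : ∑ f, (Pi.single (0 : Fin 4) (1 : ZMod 4) : PT) f = 1 := by
  rw [Fin.sum_univ_four]; simp

/-- **μ = −32 · (N(0) + i · N(e₀))**. -/
theorem moment_one_eq_boxSums (ω : PT → ℝ) (hK : ∀ k, KAdm k → moment ω k = 0) :
    moment ω (fun _ => 1) = -32 * ((boxSum ω 0 : ℂ) + (boxSum ω (Pi.single 0 1) : ℂ) * Complex.I) := by
  have h0 := boxLaw ω hK 0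
  have h1 := boxLaw ω hK (Pi.single 0 1)
  simp only [Pi.zero_apply, Finset.sum_const_zero, neg_zero, e_zero, one_mul] at h0
  rw [sum_single_zero_one, e_neg_one] at h1
  have h1' : 32 * boxSum ω (Pi.single 0 1) = -(moment ω (fun _ => 1)).im := by
    rw [h1]; simp
  apply Complex.ext
  · simp; linarith
  · simp; linarith

theorem boxSum_intCast (ω : PT → ℤ) (s : PT) :
    boxSum (fun τ => (ω τ : ℝ)) s = ((∑ τ ∈ pbox s, ω τ : ℤ) : ℝ) := by
  unfold boxSum; push_cast; rfl

/-- **integrality**: for an integer clean measure, `μ ∈ 32ℤ[i]`. -/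
theorem moment_one_mem_32 (ω : PT → ℤ) (hK : ∀ k, KAdm k → moment (fun τ => (ω τ : ℝ)) k = 0) :
    ∃ a b : ℤ, moment (fun τ => (ω τ : ℝ)) (fun _ => 1) = ((32 * a : ℤ) : ℂ) + ((32 * b : ℤ) : ℂ) * Complex.I := by
  refine ⟨-∑ τ ∈ pbox 0, ω τ, -∑ τ ∈ pbox (Pi.single 0 1), ω τ, ?_⟩
  rw [moment_one_eq_boxSums _ hK, boxSum_intCast, boxSum_intCast]
  push_cast; ring

/-- **the gap**: `μ ≠ 0 ⇒ ‖μ‖ ≥ 32`. -/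
theorem norm_moment_one_ge (ω : PT → ℤ) (hK : ∀ k, KAdm k → moment (fun τ => (ω τ : ℝ)) k = 0)
    (hμ : moment (fun τ => (ω τ : ℝ)) (fun _ => 1) ≠ 0) : 32 ≤ ‖moment (fun τ => (ω τ : ℝ)) (fun _ => 1)‖ := by
  obtain ⟨a, b, hab⟩ := moment_one_mem_32 ω hK
  rw [hab] at hμ ⊢
  have hne : a ≠ 0 ∨ b ≠ 0 := by
    by_contra h
    push_neg at h
    obtain ⟨rfl, rfl⟩ := h
    simp at hμ
  have hsq : (1 : ℝ) ≤ (a : ℝ) ^ 2 + (b : ℝ) ^ 2 := by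
    have h1 : (1 : ℤ) ≤ a ^ 2 + b ^ 2 := by
      rcases hne with h | h
      · have := Int.one_le_abs h; nlinarith [sq_abs a, sq_nonneg b, abs_nonneg a]
      · have := Int.one_le_abs h; nlinarith [sq_abs b, sq_nonneg a, abs_nonneg b]
    exact_mod_cast h1
  have key : (32 : ℝ) ^ 2 ≤ ‖((32 * a : ℤ) : ℂ) + ((32 * b : ℤ) : ℂ) * Complex.I‖ ^ 2 := by
    rw [Complex.sq_norm, Complex.normSq_apply]
    simp
    nlinarith [hsq]
  nlinarith [norm_nonneg (((32 * a : ℤ) : ℂ) + ((32 * b : ℤ) : ℂ) * Complex.I), key]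


/-! ## §6 the phase-torus law at corank ≤ 10: box law + double counting over one box class -/

/-- the corner of class `j` with prescribed first three coordinates. -/
def cornerOf (j : ZMod 4) (t : Fin 3 → ZMod 4) : PT := ![t 0, t 1, t 2, j - (t 0 + t 1 + t 2)]

/-- the 64 corners `s` with `Σ_f s f = j`. -/
def cornerClass (j : ZMod 4) : Finset PT := Finset.univ.image (cornerOf j)

theorem cornerOf_injective (j : ZMod 4) : Function.Injective (cornerOf j) := by
  intro t t' h
  have h0 := congr_fun h 0
  have h1 := congr_fun h 1
  have h2 := congr_fun h 2
  simp [cornerOf] at h0 h1 h2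
  funext i
  fin_cases i
  · exact h0
  · exact h1
  · exact h2

theorem cornerClass_card (j : ZMod 4) : (cornerClass j).card = 64 := by
  rw [cornerClass, Finset.card_image_of_injective _ (cornerOf_injective j), Finset.card_univ, Fintype.card_fun,
    ZMod.card, Fintype.card_fin]
  norm_num

theorem sum_cornerOf (j : ZMod 4) (t : Fin 3 → ZMod 4) : ∑ f, cornerOf j t f = j := by
  rw [Fin.sum_univ_four]
  simp [cornerOf]

theorem sum_of_mem_cornerClass {j : ZMod 4} {s : PT} (hs : s ∈ cornerClass j) : ∑ f, s f = j := by
  obtain ⟨t, _, rfl⟩ := Finset.mem_image.1 hs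
  exact sum_cornerOf j t

/-- a box of positive mass contains a point of the positive set. -/
theorem exists_mem_of_boxSum_pos (ω : PT → ℝ) (A : Finset PT) (hω : ∀ τ, τ ∉ A → ω τ ≤ 0) (s : PT)
    (h : 0 < boxSum ω s) : ∃ a ∈ A, a ∈ pbox s := by
  by_contra hc
  push_neg at hc
  have : boxSum ω s ≤ 0 := Finset.sum_nonpos fun τ hτ => hω τ (fun ha => hc τ ha hτ)
  linarith

/-- subsets of `Fin 4` of a given cardinality mod 4: at most `6`. -/
theorem card_subsets_le_six (r : ZMod 4) :
    ((Finset.univ : Finset (Finset (Fin 4))).filter (fun U => ((U.card : ℕ) : ZMod 4) = r)).card ≤ 6 := by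
  revert r; decide

theorem succ_ne_self4 (x : ZMod 4) : x + 1 ≠ x := by
  rw [add_comm]; exact one_add_ne x

/-- a point lies in at most `6` boxes of one class. -/
theorem card_corners_containing_le (j : ZMod 4) (a : PT) :
    ((cornerClass j).filter fun s => a ∈ pbox s).card ≤ 6 := by
  let T : PT → Finset (Fin 4) := fun s => Finset.univ.filter fun f => a f = s f + 1
  calc ((cornerClass j).filter fun s => a ∈ pbox s).card
      ≤ ((Finset.univ : Finset (Finset (Fin 4))).filter (fun U => ((U.card : ℕ) : ZMod 4) = ∑ f, a f - j)).card := by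
        apply Finset.card_le_card_of_injOn T
        · intro s hs
          have hs' : s ∈ (cornerClass j).filter fun s => a ∈ pbox s := by exact_mod_cast hs
          obtain ⟨hsj, hbox⟩ := Finset.mem_filter.1 hs'
          have goal : T s ∈ (Finset.univ : Finset (Finset (Fin 4))).filter
              (fun U => ((U.card : ℕ) : ZMod 4) = ∑ f, a f - j) := by
            rw [Finset.mem_filter]
            refine ⟨Finset.mem_univ _, ?_⟩
            have key : ∑ f, a f = ∑ f, s f + ((T s).card : ZMod 4) := by
              rw [Finset.card_eq_sum_ones, Nat.cast_sum, Finset.sum_filter, ← Finset.sum_add_distrib]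
              refine Finset.sum_congr rfl fun f _ => ?_
              rcases (mem_pbox.1 hbox) f with h | h
              · have hne : ¬ (a f = s f + 1) := by rw [h]; exact (succ_ne_self4 (s f)).symm
                rw [if_neg hne, add_zero, h]
              · rw [if_pos h, Nat.cast_one, h]
            rw [key, sum_of_mem_cornerClass hsj]; ring
          exact_mod_cast goal
        · intro s hs s' hs' hT
          have hs1 : s ∈ (cornerClass j).filter fun s => a ∈ pbox s := by exact_mod_cast hs
          have hs2 : s' ∈ (cornerClass j).filter fun s => a ∈ pbox s := by exact_mod_cast hs'
          have hb := (Finset.mem_filter.1 hs1).2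
          have hb' := (Finset.mem_filter.1 hs2).2
          funext f
          have hf : (a f = s f + 1 ↔ a f = s' f + 1) := by
            have := congrArg (fun U => f ∈ U) hT
            simpa [T] using this
          rcases (mem_pbox.1 hb) f with h | h <;> rcases (mem_pbox.1 hb') f with h' | h'
          · rw [← h, ← h']
          · exfalso
            have := hf.2 h'
            rw [h] at this
            exact succ_ne_self4 (s f) this.symm
          · exfalso
            have := hf.1 h
            rw [h'] at this
            exact succ_ne_self4 (s' f) this.symm
          · have := h.symm.trans h'
            exact add_right_cancel this
    _ ≤ 6 := card_subsets_le_six _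

/-- **The phase-torus law at corank ≤ 10** (box law + double counting: a transversal of a box class has ≥ 11 points). -/
theorem phaseTorusLawN_ten : PhaseTorusLawN 10 := by
  classical
  intro ω A hA hω hK
  by_contra hμ
  have hcls : ∀ (j : ZMod 4) (s : PT), s ∈ cornerClass j →
      32 * boxSum ω s = -(e (-j) * moment ω (fun _ => 1)).re := by
    intro j s hs
    rw [boxLaw ω hK s, sum_of_mem_cornerClass hs]
  obtain ⟨j, hj⟩ : ∃ j : ZMod 4, ∀ s ∈ cornerClass j, 0 < boxSum ω s := by
    have hre_or : (moment ω (fun _ => 1)).re ≠ 0 ∨ (moment ω (fun _ => 1)).im ≠ 0 := by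
      by_contra h
      push_neg at h
      exact hμ (Complex.ext (by simpa using h.1) (by simpa using h.2))
    rcases hre_or with h | h
    · rcases lt_or_gt_of_ne h with hneg | hpos
      · refine ⟨0, fun s hs => ?_⟩
        have := hcls 0 s hs
        rw [neg_zero, e_zero, one_mul] at this
        linarith
      · refine ⟨2, fun s hs => ?_⟩
        have := hcls 2 s hs
        rw [show (-2 : ZMod 4) = 2 from by decide, e_two] at this
        simp at this
        linarith
    · rcases lt_or_gt_of_ne h with hneg | hpos
      · refine ⟨1, fun s hs => ?_⟩
        have := hcls 1 s hs
        rw [e_neg_one] at this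
        simp at this
        linarith
      · refine ⟨3, fun s hs => ?_⟩
        have := hcls 3 s hs
        rw [show (-3 : ZMod 4) = 1 from by decide, e_one] at this
        simp at this
        linarith
  have hmeet : ∀ s ∈ cornerClass j, ∃ a ∈ A, a ∈ pbox s :=
    fun s hs => exists_mem_of_boxSum_pos ω A hω s (hj s hs)
  choose! g hgA hgbox using hmeet
  have h1 : (cornerClass j).card ≤ 6 * ((cornerClass j).image g).card := by
    apply Finset.card_le_mul_card_image
    intro a _
    calc ((cornerClass j).filter fun s => g s = a).card
        ≤ ((cornerClass j).filter fun s => a ∈ pbox s).card := by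
          apply Finset.card_le_card
          intro s hs
          rw [Finset.mem_filter] at hs ⊢
          exact ⟨hs.1, hs.2 ▸ hgbox s hs.1⟩
      _ ≤ 6 := card_corners_containing_le j a
  have h2 : ((cornerClass j).image g).card ≤ A.card :=
    Finset.card_le_card (Finset.image_subset_iff.2 fun s hs => hgA s hs)
  rw [cornerClass_card] at h1
  omega

end Summit.HodgeConjecture.HodgeConjecture.Cruxes.BlochSeedDiscOne.PhaseTorus
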